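/-
Copyright: cell pub-balaban-gaps (YM BLITZ Y1, track G1), seat g1-p2 (unit `pub-balaban-gaps-g1-p2-g0`).  Row (D4).NODE-A ∕ NODE-O
«k = 0 special case under Gaps/» (cell table BALABAN-GAPS.md v0.4.2 row (D4).NODE-A; plan `g1/G1-PLAN-D4.md` §4): the PER-SCALE and
SCALE-ZERO slices of the row-D4 END, stated over the an4 socket's own leaf type (`Beta.RemainderLocalityHolo.PolLeavesTFac190H`,
holomorphic currency) — NO new objects, NO new definitions.  HONEST FRAMING: bookkeeping BY IMPORT over the an4 reduction chain
(the four lines of `ChainTLocH.abs_beta1_le` run at ONE (scale, history)); nothing of Bałaban's is asserted; the k = 0 leaves for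
Bałaban's first step are 0∕1 in the tree; NOT BetaPertH, NOT continuum, NOT Clay.
-/
import Literature.MathematicalPhysics.QuantumFieldTheory.Balaban1983to89.Beta.RemainderResidue
import Literature.MathematicalPhysics.QuantumFieldTheory.Balaban1983to89.Beta.RemainderStepAdapterHolo

/-!
# `Gaps.D4ScaleSlice` — binder (D4) scale by scale: the remainder bound AT ONE (k, p) from the leaves AT THAT (k, p), and the
# k = 0 special case «(D4) at the first renormalization step ⟸ the first-step leaves» (cell pub-balaban-gaps, seat g1-p2)

HONEST DEPENDENCY (cell pub-balaban, verbatim): continuum YM on T⁴ ⇐ BetaPertH ∧ nine spine estimates (0/9 proved);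
BetaPertH ⇐ (D1) ∧ (D4) ∧ CAP+tail.

WHY THIS FILE.  The row-D4 END of record `Beta.RemainderDecay190HoloChain.ChainTFac190H.abs_beta1_le` consumes ONE chain = leaves at
EVERY scale `k` and history `p`.  Its proof is scale-local: at a fixed `(k, p)` the leaf list `PolLeavesTFac190H 4 M (A1 k p) c ℓ α₂ q`
ALONE (+ the dictionary clause `β¹_{k+1}(p) = Σ_x Π¹(x)x_μx_ν` and the numeric side conditions) gives
`|β¹_{k+1}(p)| ≤ ε₁·K_rem,L`.  The cell's plan (`g1/G1-PLAN-D4.md` v1.3 §4) singles out k = 0 — the FIRST step from the bare Wilson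
action (one propagator level, no averaged configurations, k-uniformity vacuous) — as the first special case the chain consumes; the
cross-read `g1/D4-NODEA-K0-LINEREAD.md` records that at k = 0 the proof of [II] Lemma 3 still routes through the asserted display
(2.16).  This file makes the k = 0 OBLIGATION a Lean statement over the tree's own types: `remainderConst_scaleZero_of_leaves`.

## What is here (kernel-checked, 0 sorry, 0 def)

* `abs_beta1_le_of_leaves_at` — AT ONE (k, p): leaves `PolLeavesTFac190H 4 M A1 c ℓ α₂ q` for the limit remainder kernel `A1`
  read out by `Sβ.β1 k p` + N1 `CondsL` + closing relation + N2 (`Valid`, `SignsL`) ⟹ `|Sβ.β1 k p| ≤ ε₁·K_rem,L(4, M, c, α₂, B₃(q))`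
  (the four lines of `ChainTLocH.abs_beta1_le`, through `toPolLeavesTFacH` ∘ `toPolLeavesTLocH` ∘ `decay510` ∘
  `RemainderChain.abs_secondMoment_le_linear`).
* `beta1_scaleZero_le_of_leaves` — THE k = 0 SPECIAL CASE: for every one-point history `p = (g₀) ∈ ]0,γ₀]` the first-step leaves
  give `|β¹₁(g₀)| ≤ ε₁·K_rem,L`; `remainderConst_scaleZero_of_leaves`: with the smallness `ε₁·K_rem,L ≤ s`, the k = 0 slice of (D4)
  at slope `s` — the statement «(D4) at the first step ⟸ [II] Lemma 3 (2.38) + [I] (4.4)/(4.35)/p. 282 + [15] (190) + (1.7) FOR THE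
  FIRST STEP'S OBJECTS», objects and leaves being hypotheses (0∕1 in the tree).
* `remainderConst_of_leaves_allScales` — all scales at once from per-(k,p) leaves = `ChainTFac190H.abs_beta1_le` re-assembled (sanity:
  the per-scale slices compose back to the END of record; the row owner's capstone with the leaf FUNCTION given directly is
  `Beta.RemainderStepAdapterHolo.remainderConst_of_leafLists`, p340881, filed on this cell's INTERFACE REQUEST — cite by name once landed).

* §4 (v1.1) `abs_beta1_le_of_stepObjects_at` — the same bound AT ONE (k, p) directly from a torus family of the row owner's NODE-O records
  `RemainderStepAdapterHolo.StepObjectD4` (p340881, filed on this cell's INTERFACE REQUEST) + (2.38) on the activities + seam∕(190)∕(1.7)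
  data: `abs_beta1_le_of_leaves_at ∘ toPolLeavesTFac190H_ofActivities` — «first-step `StepObjectD4` objects ⟹ (D4) at that scale».

## What is NOT here

No object of Bałaban's first step (NODE O at k = 0: the complexified configurations on T_N^{(1)}, 𝔘ᶜ₁(Z), the (2.13)-resummed
activities of the FIRST fluctuation integral — `g1/G1-PLAN-D4.md` §6 (L0)), no leaf instance, no new definition.  No `sorry`.
-/

namespace Summit.QuantumFields.BalabanUV.Gaps.D4ScaleSlice

open Literature.MathematicalPhysics.QuantumFieldTheory.Balaban1983to89
open FlowStep
open Literature.MathematicalPhysics.QuantumFieldTheory.Balaban1983to89.B13ScaleTransfer (Pt)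
open Literature.MathematicalPhysics.QuantumFieldTheory.Balaban1983to89.Beta.RemainderChain (RemainderConst abs_secondMoment_le_linear)
open Literature.MathematicalPhysics.QuantumFieldTheory.Balaban1983to89.Beta.RemainderChainLattice
  (CondsL SignsL remCoeffL deltaL deltaL_pos eps1_mul_remCoeffL)
open Literature.MathematicalPhysics.QuantumFieldTheory.Balaban1983to89.Beta.RemainderLimitTorus (LDom limKernel)
open Literature.MathematicalPhysics.QuantumFieldTheory.Balaban1983to89.Beta.RemainderLocalityHolo (PolLeavesTFac190H)
open Literature.MathematicalPhysics.QuantumFieldTheory.Balaban1983to89.Beta.RemainderDecay190 (Consts190)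

noncomputable section

variable {M : ℕ} [NeZero M] {μ ν : Fin 4} {β : HBeta} {Sβ : B12Beta.OneLoopSplit β} {c : B13.Consts} {ℓ α₂ : ℝ}
  {q : Consts190}

/-! ## §1 AT ONE (scale, history): the leaves at (k, p) bound β¹_{k+1}(p) -/

/-- **THE REMAINDER BOUND AT ONE (k, p) FROM THE LEAVES AT THAT (k, p)**: the holomorphic-currency leaf list with the (190)-side
data for the limit remainder kernel `A1` of scale `k` and history `p` ([II] Lemma 3 (2.38), [I] (4.4)/(4.35)/p. 282 ⟵ [15] (190),
(1.7), as hypothesis fields), the (1.20)–(1.22) read-out `Sβ.β1 k p = Σ_x Π¹(x)x_μx_ν`, N1 (`CondsL`), the closing relation, N2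
(`Valid`, `SignsL`) ⟹ `|β¹_{k+1}(p)| ≤ ε₁·K_rem,L` — the four lines of `ChainTLocH.abs_beta1_le` at one index.
[cite: Balaban1988RG2Cluster, Lemma 3 (2.38) p.20; Balaban1987RG1, (5.10) p.293 and (1.22) p.264; Balaban1985Variational, (190) p.308] -/
theorem abs_beta1_le_of_leaves_at {k : ℕ} {p : Fin (k + 1) → ℝ} (A1 : LDom 4 → Pt 4 → ℝ)
    (L : PolLeavesTFac190H 4 M A1 c ℓ α₂ q)
    (hβ1 : Sβ.β1 k p = B12Beta.secondMoment (fun _ _ => limKernel A1) μ ν)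
    (hC : CondsL 4 c ℓ) (h22 : c.R22gen ℓ) (hq : q.Valid c.δ₀) (hs : SignsL c α₂ q.B₃) :
    |Sβ.β1 k p| ≤ c.ε₁ * remCoeffL 4 M c α₂ q.B₃ := by
  have hd : 0 < 4 := by norm_num
  have hδ₁ : 0 < deltaL 4 M c := deltaL_pos hC hs.δ₀_pos hd (Nat.pos_of_neZero M)
  have hdec := ((L.toPolLeavesTFacH hq).toPolLeavesTLocH hs.α₂_pos).decay510 hC h22 hs hd
  rw [hβ1, eps1_mul_remCoeffL]
  exact abs_secondMoment_le_linear hδ₁ hdec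

/-- The same with the smallness clause folded in: leaves at (k, p) + `ε₁·K_rem,L ≤ s` ⟹ `|β¹_{k+1}(p)| ≤ s`.
[cite: Balaban1988RG2Cluster, (2.38) p.20 and p.21; Balaban1987RG1, (1.22) p.264] -/
theorem abs_beta1_le_of_leaves_at_slope {k : ℕ} {p : Fin (k + 1) → ℝ} (A1 : LDom 4 → Pt 4 → ℝ)
    (L : PolLeavesTFac190H 4 M A1 c ℓ α₂ q)
    (hβ1 : Sβ.β1 k p = B12Beta.secondMoment (fun _ _ => limKernel A1) μ ν)
    (hC : CondsL 4 c ℓ) (h22 : c.R22gen ℓ) (hq : q.Valid c.δ₀) (hs : SignsL c α₂ q.B₃) {s : ℝ}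
    (hsmall : c.ε₁ * remCoeffL 4 M c α₂ q.B₃ ≤ s) : |Sβ.β1 k p| ≤ s :=
  (abs_beta1_le_of_leaves_at A1 L hβ1 hC h22 hq hs).trans hsmall

/-! ## §2 THE k = 0 SPECIAL CASE: (D4) at the first renormalization step from the first step's leaves -/

/-- **(D4) AT SCALE k = 0 FROM THE FIRST STEP'S LEAVES**: if for every one-point history `p = (g₀) ∈ ]0, γ₀]` the FIRST step's
objects (one propagator level, Wilson-action background, no averaged configurations — `g1/G1-PLAN-D4.md` §4) carry a leaf list
`PolLeavesTFac190H 4 M (A1 p) c ℓ α₂ q` read out by `β¹₁(g₀)`, then `|β¹₁(g₀)| ≤ ε₁·K_rem,L` on `]0, γ₀]`.  The leaves are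
HYPOTHESES (0∕1 in the tree for Bałaban's first step; [II] Lemma 3 at k = 0 still routes through the asserted display (2.16),
`g1/D4-NODEA-K0-LINEREAD.md`). [cite: Balaban1988RG2Cluster, Lemma 3 (2.38) p.20; Balaban1987RG1, (1.22) p.264 and (5.10) p.293] -/
theorem beta1_scaleZero_le_of_leaves {γ₀ : ℝ} (A1 : (Fin (0 + 1) → ℝ) → LDom 4 → Pt 4 → ℝ)
    (hL : ∀ p, p ∈ B12Beta.HistBox γ₀ 0 → Nonempty (PolLeavesTFac190H 4 M (A1 p) c ℓ α₂ q))
    (hβ1 : ∀ p, p ∈ B12Beta.HistBox γ₀ 0 → Sβ.β1 0 p = B12Beta.secondMoment (fun _ _ => limKernel (A1 p)) μ ν)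
    (hC : CondsL 4 c ℓ) (h22 : c.R22gen ℓ) (hq : q.Valid c.δ₀) (hs : SignsL c α₂ q.B₃) :
    ∀ p, p ∈ B12Beta.HistBox γ₀ 0 → |Sβ.β1 0 p| ≤ c.ε₁ * remCoeffL 4 M c α₂ q.B₃ := fun p hp => by
  obtain ⟨L⟩ := hL p hp
  exact abs_beta1_le_of_leaves_at (A1 p) L (hβ1 p hp) hC h22 hq hs

/-- **THE k = 0 SLICE OF (D4) AT SLOPE `s`**: first-step leaves + N1–N2 + `ε₁·K_rem,L ≤ s` ⟹ `|β¹₁(g₀)| ≤ s` for every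
`g₀ ∈ ]0, γ₀]` — the scale-zero instance of the wall's `RemainderConst Sβ γ₀ s` (which quantifies over ALL scales).
[cite: Balaban1987RG1, Thm 2 p.259 and (1.22) p.264; Balaban1988RG2Cluster, (2.38) p.20 and p.21] -/
theorem remainderConst_scaleZero_of_leaves {γ₀ s : ℝ} (A1 : (Fin (0 + 1) → ℝ) → LDom 4 → Pt 4 → ℝ)
    (hL : ∀ p, p ∈ B12Beta.HistBox γ₀ 0 → Nonempty (PolLeavesTFac190H 4 M (A1 p) c ℓ α₂ q))
    (hβ1 : ∀ p, p ∈ B12Beta.HistBox γ₀ 0 → Sβ.β1 0 p = B12Beta.secondMoment (fun _ _ => limKernel (A1 p)) μ ν)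
    (hC : CondsL 4 c ℓ) (h22 : c.R22gen ℓ) (hq : q.Valid c.δ₀) (hs : SignsL c α₂ q.B₃)
    (hsmall : c.ε₁ * remCoeffL 4 M c α₂ q.B₃ ≤ s) :
    ∀ p, p ∈ B12Beta.HistBox γ₀ 0 → |Sβ.β1 0 p| ≤ s := fun p hp =>
  (beta1_scaleZero_le_of_leaves A1 hL hβ1 hC h22 hq hs p hp).trans hsmall

/-- The wall's all-scales binder restricted to scale 0 is exactly the k = 0 slice (so a proof of (D4) yields it, and the k = 0
slice is a NECESSARY first case). [cite: Balaban1987RG1, Thm 2 p.259] -/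
theorem scaleZero_of_remainderConst {γ₀ s : ℝ} (h : RemainderConst Sβ γ₀ s) :
    ∀ p, p ∈ B12Beta.HistBox γ₀ 0 → |Sβ.β1 0 p| ≤ s := fun p hp => h 0 p hp

/-! ## §3 Sanity: the per-(k,p) slices re-assemble the END of record -/

/-- **ALL SCALES FROM PER-(k, p) LEAVES** — the chain of record re-assembled from its slices: leaves at EVERY (k, p) in the box +
the read-out + N1–N2 ⟹ `RemainderConst Sβ γ₀ (ε₁·K_rem,L)`; equal to `ChainTFac190H.abs_beta1_le` on the chain built from the
slices (no new content — a check that §1 is the END's scale-local core).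
[cite: Balaban1988RG2Cluster, (2.38) p.20; Balaban1987RG1, (1.22) p.264; Balaban1985Variational, (190) p.308] -/
theorem remainderConst_of_leaves_allScales {γ₀ : ℝ} (A1 : (k : ℕ) → (Fin (k + 1) → ℝ) → LDom 4 → Pt 4 → ℝ)
    (hL : ∀ k p, p ∈ B12Beta.HistBox γ₀ k → Nonempty (PolLeavesTFac190H 4 M (A1 k p) c ℓ α₂ q))
    (hβ1 : ∀ k p, p ∈ B12Beta.HistBox γ₀ k → Sβ.β1 k p = B12Beta.secondMoment (fun _ _ => limKernel (A1 k p)) μ ν)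
    (hC : CondsL 4 c ℓ) (h22 : c.R22gen ℓ) (hq : q.Valid c.δ₀) (hs : SignsL c α₂ q.B₃) :
    RemainderConst Sβ γ₀ (c.ε₁ * remCoeffL 4 M c α₂ q.B₃) := fun k p hp => by
  obtain ⟨L⟩ := hL k p hp
  exact abs_beta1_le_of_leaves_at (A1 k p) L (hβ1 k p hp) hC h22 hq hs

/-! ## §4 (v1.1) AT ONE (scale, history) FROM THE ROW OWNER's NODE-O ADAPTER `StepObjectD4` (p340881, filed on this cell's
INTERFACE REQUEST): step objects + (2.38) on their activities + the seam∕(190)∕(1.7) data ⟹ the bound at (k, p); k = 0 form -/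

section StepObjects

open Filter Metric
open scoped Topology
open Literature.MathematicalPhysics.QuantumFieldTheory.Balaban1983to89.TreeLengthTorus (TDom proj)
open Literature.MathematicalPhysics.QuantumFieldTheory.Balaban1983to89.Beta.RemainderLimitTorus (tproj)
open Literature.MathematicalPhysics.QuantumFieldTheory.Balaban1983to89.Beta.RemainderDecay190 (Data190)
open Literature.MathematicalPhysics.QuantumFieldTheory.Balaban1983to89.B12Decay510 (mixedDeriv)
open Literature.MathematicalPhysics.QuantumFieldTheory.Balaban1983to89.Beta.RemainderStepAdapterHolo
  (StepObjectD4 toPolLeavesTFac190H_ofActivities)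

/-- **(D4) AT ONE (k, p) FROM `StepObjectD4` OBJECTS** — the two-name composition announced in the INTERFACE REQUEST: a torus family of
the owner's NODE-O records `O n : StepObjectD4 4 (N n)` (Φ, 𝔘ᶜ_{k+1}, the resummed activities H; [II] (2.1)–(2.13)) with [II] Lemma 3
(2.38) ON THE ACTIVITIES (`Lemma3OnH`), the (4.4)-seam `emb` landing in 𝔘ᶜ with the activities complex-differentiable along it ([I]
p. 281, [II] p. 15), the (190)-side data `D` ([15] (190)), the (1.7)-factorization ∕ test-vector data and the (1.22) read-out of
`Sβ.β1 k p` through the limit kernel `a` — all HYPOTHESES — together with N1 (`CondsL`), the closing relation and N2 (`Valid`, `SignsL`)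
give `|β¹_{k+1}(p)| ≤ ε₁·K_rem,L(4, M, c, α₂, B₃(q))`:
`abs_beta1_le_of_leaves_at ∘ RemainderStepAdapterHolo.toPolLeavesTFac190H_ofActivities`.  Nothing of Bałaban's is asserted; his
first-step objects inhabiting `StepObjectD4` are 0∕1 in the tree.
[cite: Balaban1988RG2Cluster, (2.13) p.14, p.15 and Lemma 3 (2.38) p.20; Balaban1987RG1, (1.7) p.261, (1.22) p.264, (4.4) p.281, (4.35) p.290; Balaban1985Variational, (190) p.308] -/
theorem abs_beta1_le_of_stepObjects_at {k : ℕ} {p : Fin (k + 1) → ℝ}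
    (N : ℕ → ℕ) [hN : ∀ n, NeZero (N n)] (hNlim : Tendsto N atTop atTop)
    (O : (n : ℕ) → StepObjectD4 4 (N n)) (h3 : ∀ n, (O n).Lemma3OnH c ℓ)
    (Wn : ℕ → Type) [instW : ∀ n, NormedAddCommGroup (Wn n)] [instWs : ∀ n, NormedSpace ℂ (Wn n)]
    (emb : (n : ℕ) → TDom 4 (N n) → Wn n → (O n).Φ)
    (hemb : ∀ n X, ∀ v ∈ ball (0 : Wn n) α₂, emb n X v ∈ (O n).sp2 X)
    (hH : ∀ n (X Z : TDom 4 (N n)), Z.1 ⊆ X.1 →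
      DifferentiableOn ℂ (fun v => (O n).H Z (emb n X v)) (ball 0 α₂))
    (D : Data190 4 M N Wn q)
    (V : LDom 4 → Type) [instV : ∀ Y, NormedAddCommGroup (V Y)] [instVs : ∀ Y, NormedSpace ℂ (V Y)]
    (F : (Y : LDom 4) → V Y → ℂ) (hFd : ∀ Y, ∃ ρ > 0, DifferentiableOn ℂ (F Y) (ball 0 ρ))
    (r : (n : ℕ) → (Y : LDom 4) → Wn n →L[ℂ] V Y)
    (hfac : ∀ Y : LDom 4, ∀ᶠ n in atTop, ∀ v ∈ ball (0 : Wn n) α₂,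
      (O n).E (tproj (N n) Y) (emb n (tproj (N n) Y) v) = F Y (r n Y v))
    (t : (Y : LDom 4) → Pt 4 → V Y)
    (hconv : ∀ (Y : LDom 4) (x : Pt 4),
      Tendsto (fun n => r n Y (D.hn n (tproj (N n) Y) (proj (N n * M) x))) atTop (𝓝 (t Y x)))
    (a : LDom 4 → Pt 4 → ℝ) (ha : ∀ (Y : LDom 4) (z : Pt 4), a Y z = (mixedDeriv (F Y) (t Y 0) (t Y z)).re)
    (hβ1 : Sβ.β1 k p = B12Beta.secondMoment (fun _ _ => limKernel a) μ ν)
    (hC : CondsL 4 c ℓ) (h22 : c.R22gen ℓ) (hq : q.Valid c.δ₀) (hs : SignsL c α₂ q.B₃) :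
    |Sβ.β1 k p| ≤ c.ε₁ * remCoeffL 4 M c α₂ q.B₃ :=
  abs_beta1_le_of_leaves_at a
    (toPolLeavesTFac190H_ofActivities N hNlim O c ℓ α₂ q h3 hC hs.A Wn emb hemb hH D V F hFd r hfac t hconv a ha)
    hβ1 hC h22 hq hs

end StepObjects

end

end Summit.QuantumFields.BalabanUV.Gaps.D4ScaleSlice
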